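/-
Copyright (c) 2026. All rights reserved.
Released under Apache 2.0 license as described in the file LICENSE.
Authors: abc-iut cell, seat abc-iut-L4-t10 (gen 4; geometric `EA` column of [AbsTopIII] Prop 4.2 (i) /
Cor 4.5 — consumer of abc-iut-w5-d144's Galois descent at an arbitrary connected Riemann surface).
-/
import Literature.AnabelianGeometry.AbsoluteAnabelian.ArchimedeanHolFieldFunctorGeometricGaloisDescent
import HarnessLib

/-!
# [AbsTopIII] Prop 4.2 (i) / Cor 4.5 at the geometric `EA` of everything finite étale over ONE connected
# Riemann surface `𝕏`, from the Galois descent (abc-iut-w5-d144) — the general-`𝕏` form of the tripod file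

S. Mochizuki, *Topics in Absolute Anabelian Geometry III*, proof of Prop 4.2 (i), kurims p.106 l.11–19
(«for any object `X` of `EA`, the full subcategory of `EA` consisting of objects that map to `X` … [is
id-rigid]; thus, the id-rigidity of `EA` follows»), Lemma 4.3 p.106, Cor 4.5 pp.107–109 (lit key
`paper:url-5493eb38cbb7`; bib key `MochizukiAbsTopIII2015`).  PROOF-ONLY file (no definition).

abc-iut-w5-d144's `ArchimedeanHolFieldFunctorGeometricGaloisDescent.lean` (p443623, over abc-iut-w6-d003's
`IdRigidEpiCoverDescent` p441434 and abc-iut-L4-t12's slice reduction) proves, for a connected Riemann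
surface `𝕏`, that the full subcategory of `HolRS` of objects mapping to `𝕏` is id-rigid (a) as soon as the
GALOIS finite étale coverings of `𝕏` span an id-rigid full subcategory
(`HolRS.isIdRigid_mapsTo_of_isIdRigid_galois`, no hypothesis on `Aut 𝕏`), or (b) when `π̂₁(𝕏^top, x₀)` is
centre-free / slim and (H1′) holds at `𝕏` («an automorphism of `𝕏` whose pull-back on the slice is
isomorphic to the identity is trivial», `isIdRigid_mapsTo_of_twist_of_center_eq_bot` / `_of_isSlimGroup`).
That full subcategory IS the `EA` of abc-iut-L4-t14's geometric interface datum at the object property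
`Q_𝕏 :=` «admits a holomorphic finite étale map to `𝕏`» (`HolRS.geometric_EA`, definitionally) — the
observation of seat abc-iut-L4-t10's `ArchimedeanHolFieldFunctorGeometricTripodCovers.lean` (p441965, the
tripod and `ℂ ∖ {p, q}` outright).  This file records the consequences for the model of Cor 4.5:

* `HolRS.isIdRigid_EA_mapsTo_of_isIdRigid_galois`, `…_of_twist_of_center_eq_bot`, `…_of_twist_of_isSlimGroup`
  — print's conclusion «`EA` is id-rigid» for `EA^hol_RS(Q_𝕏)`, under (a) resp. (b);
* `HolRS.isIdRigid_pairs_mapsTo_of_twist_of_isSlimGroup` — Prop 4.2 (i) for `𝒞^hol_TF` / `𝒞^hol_T` there;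
* `HolRS.cor_4_5_geometric_mapsTo_of_isIdRigid_galois`, `…_of_twist_of_isSlimGroup`,
  `…_of_twist_of_center_eq_bot` — **[AbsTopIII] Cor 4.5 (i)–(v) AS TYPED for the archimedean
  log-Frobenius data over `EA^hol_RS(Q_𝕏)`, for EVERY connected Riemann surface `𝕏`, modulo exactly
  w5-d144's inputs** (seat abc-iut-L4-t10's `cor_4_5_geometric`, object `𝕏₀ := 𝕏`).

HONEST SCOPE: model-level; (H1′) and the slimness of `π̂₁(𝕏^top)` (print's Lemma 4.3, needing the
identification `π₁(𝕏^top) ≅ Γ_{g,r}` for a general hyperbolic `𝕏`) stay HYPOTHESES here — they are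
DISCHARGED in the tree for `𝕏 = ℂ ∖ {p,q}` (p441622 / p441965) and, slimness only, for the finite covers
of `ℂ ∖ F` (abc-iut-L6-t18); node `AbsTopIII:Cor4.5` is not a counting node.  Refereed pre-IUT anabelian
geometry; nothing here bears on [IUTchIII] Cor. 3.12 or takes a side; typed ≠ proved.
-/

noncomputable section

open CategoryTheory CategoryTheory.PreGaloisCategory
open Literature.Topology.CoveringSpaces
open Literature.AlgebraicGeometry.Frobenioids (IsSlimGroup)
open Literature.IUT.HodgeTheaters (profiniteCompletion)

namespace Literature.AnabelianGeometry.AbsoluteAnabelian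

namespace HolRS

variable (X : HolRS)

/-! ### `EA^hol_RS(Q_𝕏)` is id-rigid, modulo w5-d144's inputs -/

/-- **`EA^hol_RS(Q_𝕏)` is id-rigid as soon as the Galois coverings of `𝕏` span an id-rigid full
subcategory** (`Q_𝕏 :=` «admits a holomorphic finite étale map to `𝕏`»; `EA^hol_RS(Q_𝕏)` IS the full
subcategory «objects mapping to `𝕏`» of `HolRS`). [cite: MochizukiAbsTopIII2015, Proposition 4.2 (i) p.106] -/
theorem isIdRigid_EA_mapsTo_of_isIdRigid_galois [GaloisCategory (CovFin X.carrier)]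
    (hT : IsIdRigid (ObjectProperty.FullSubcategory
      fun Z : HolRS => ∃ g : Z ⟶ X, IsGalois (X.overToCovFin.obj (Over.mk g)))) :
    IsIdRigid (geometricAutHolFieldFunctor (fun Y : HolRS => Nonempty (Y ⟶ X))).EA :=
  X.isIdRigid_mapsTo_of_isIdRigid_galois hT

/-- **`EA^hol_RS(Q_𝕏)` is id-rigid when `Z(π̂₁(𝕏^top, x₀)) = 1` and (H1′) holds at `𝕏`.**
[cite: MochizukiAbsTopIII2015, Proposition 4.2 (i) p.106] -/
theorem isIdRigid_EA_mapsTo_of_twist_of_center_eq_bot (x₀ : X.carrier)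
    (hZ : Subgroup.center (profiniteCompletion (FundamentalGroup X.carrier x₀)) = ⊥)
    (h1' : ∀ σ : X ≅ X, Nonempty (Over.map σ.hom ≅ 𝟭 (Over X)) → σ.hom = 𝟙 X) :
    IsIdRigid (geometricAutHolFieldFunctor (fun Y : HolRS => Nonempty (Y ⟶ X))).EA :=
  X.isIdRigid_mapsTo_of_twist_of_center_eq_bot x₀ hZ h1'

/-- **`EA^hol_RS(Q_𝕏)` is id-rigid when `π̂₁(𝕏^top, x₀)` is slim (print's Lemma 4.3) and (H1′) holds at
`𝕏`.** [cite: MochizukiAbsTopIII2015, Proposition 4.2 (i) p.106] -/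
theorem isIdRigid_EA_mapsTo_of_twist_of_isSlimGroup (x₀ : X.carrier)
    (h : IsSlimGroup (profiniteCompletion (FundamentalGroup X.carrier x₀)))
    (h1' : ∀ σ : X ≅ X, Nonempty (Over.map σ.hom ≅ 𝟭 (Over X)) → σ.hom = 𝟙 X) :
    IsIdRigid (geometricAutHolFieldFunctor (fun Y : HolRS => Nonempty (Y ⟶ X))).EA :=
  X.isIdRigid_mapsTo_of_twist_of_isSlimGroup x₀ h h1'

/-- **Prop 4.2 (i), id-rigidity of `𝒞^hol_TF` and of `𝒞^hol_T` over `EA^hol_RS(Q_𝕏)`** when `π̂₁(𝕏^top)`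
is slim and (H1′) holds at `𝕏`. [cite: MochizukiAbsTopIII2015, Proposition 4.2 (i) p.105] -/
theorem isIdRigid_pairs_mapsTo_of_twist_of_isSlimGroup (x₀ : X.carrier)
    (h : IsSlimGroup (profiniteCompletion (FundamentalGroup X.carrier x₀)))
    (h1' : ∀ σ : X ≅ X, Nonempty (Over.map σ.hom ≅ 𝟭 (Over X)) → σ.hom = 𝟙 X)
    {T : ArchPairType} (hT : T.IsMonoidType) :
    IsIdRigid (HolTFPair (geometricAutHolFieldFunctor (fun Y : HolRS => Nonempty (Y ⟶ X)))) ∧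
    IsIdRigid (HolMonoidPair (geometricAutHolFieldFunctor (fun Y : HolRS => Nonempty (Y ⟶ X))) T) :=
  isIdRigid_pairs_of_isIdRigid_EA _ (X.isIdRigid_EA_mapsTo_of_twist_of_isSlimGroup x₀ h h1') hT

/-! ### [AbsTopIII] Cor 4.5 (i)–(v) over `EA^hol_RS(Q_𝕏)` -/

/-- **Cor 4.5 (i)–(v) AS TYPED for the archimedean log-Frobenius data over `EA^hol_RS(Q_𝕏)`, as soon as
the Galois coverings of `𝕏` span an id-rigid full subcategory** (object `𝕏₀ := 𝕏`).
[cite: MochizukiAbsTopIII2015, Corollary 4.5 pp.107–109] -/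
theorem cor_4_5_geometric_mapsTo_of_isIdRigid_galois [GaloisCategory (CovFin X.carrier)]
    (hT : IsIdRigid (ObjectProperty.FullSubcategory
      fun Z : HolRS => ∃ g : Z ⟶ X, IsGalois (X.overToCovFin.obj (Over.mk g)))) :
    AbsTopIII.Cor_4_5
      (archLogFrobeniusData (geometricAutHolFieldFunctor (fun Y : HolRS => Nonempty (Y ⟶ X))))
      (archTelecoreData (geometricAutHolFieldFunctor (fun Y : HolRS => Nonempty (Y ⟶ X)))) :=
  cor_4_5_geometric _ ⟨X, ⟨𝟙 X⟩⟩ (X.isIdRigid_EA_mapsTo_of_isIdRigid_galois hT)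

/-- **Cor 4.5 (i)–(v) AS TYPED over `EA^hol_RS(Q_𝕏)` for EVERY connected Riemann surface `𝕏` with slim
`π̂₁(𝕏^top, x₀)` (Lemma 4.3) satisfying (H1′)** — print's route Prop 4.2 (i) ⟸ Lemma 4.3 at the geometric
model, the two inputs named. [cite: MochizukiAbsTopIII2015, Corollary 4.5 pp.107–109] -/
theorem cor_4_5_geometric_mapsTo_of_twist_of_isSlimGroup (x₀ : X.carrier)
    (h : IsSlimGroup (profiniteCompletion (FundamentalGroup X.carrier x₀)))
    (h1' : ∀ σ : X ≅ X, Nonempty (Over.map σ.hom ≅ 𝟭 (Over X)) → σ.hom = 𝟙 X) :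
    AbsTopIII.Cor_4_5
      (archLogFrobeniusData (geometricAutHolFieldFunctor (fun Y : HolRS => Nonempty (Y ⟶ X))))
      (archTelecoreData (geometricAutHolFieldFunctor (fun Y : HolRS => Nonempty (Y ⟶ X)))) :=
  cor_4_5_geometric _ ⟨X, ⟨𝟙 X⟩⟩ (X.isIdRigid_EA_mapsTo_of_twist_of_isSlimGroup x₀ h h1')

/-- The same with `Z(π̂₁(𝕏^top, x₀)) = 1` in place of slimness.
[cite: MochizukiAbsTopIII2015, Corollary 4.5 pp.107–109] -/
theorem cor_4_5_geometric_mapsTo_of_twist_of_center_eq_bot (x₀ : X.carrier)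
    (hZ : Subgroup.center (profiniteCompletion (FundamentalGroup X.carrier x₀)) = ⊥)
    (h1' : ∀ σ : X ≅ X, Nonempty (Over.map σ.hom ≅ 𝟭 (Over X)) → σ.hom = 𝟙 X) :
    AbsTopIII.Cor_4_5
      (archLogFrobeniusData (geometricAutHolFieldFunctor (fun Y : HolRS => Nonempty (Y ⟶ X))))
      (archTelecoreData (geometricAutHolFieldFunctor (fun Y : HolRS => Nonempty (Y ⟶ X)))) :=
  cor_4_5_geometric _ ⟨X, ⟨𝟙 X⟩⟩ (X.isIdRigid_EA_mapsTo_of_twist_of_center_eq_bot x₀ hZ h1')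

end HolRS

end Literature.AnabelianGeometry.AbsoluteAnabelian
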